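import Summits.CriticalPhenomena.SAWScalingLimit.Theorems.SAWDevelopingMapHexTightVirginization
import Literature.Probability.RandomPlanarGeometry.ShellTraversalCutoff
import HarnessLib

/-!
# Stub `stub_virginizationTight` of the line `reversal-virgin-disc` (crux `HexTight`, stmt-CriticalPhenomena-5423)

Landing target `Summits/CriticalPhenomena/SAWScalingLimit/Theorems/SAWDevelopingMapHexTightVirginizationTight.lean`;
objects from `SAWDevelopingMapHexTightReversalDefs.lean`, machinery from the landed power-law glue
`SAWDevelopingMapHexTightVirginization.lean` (`isVirgin_sup_disc`, `arcSums_of_arcShellBound`) and its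
Literature files. WHAT: the RATE-FREE chordal (`ArcTraversalTight`) and rooted (`RootedTraversalTight`)
traversal tightness statements on a virgin lattice disc — at each aspect `A ≥ 4` and tolerance `η > 0` a
threshold `k₀(A, η)` beyond a radius `N₀(A, η)` — imply Aizenman–Burchard's hypothesis (H1) with exponent
`3` on every INTERIOR shell `D(x; ρ, R) ⊆ D` for the critical hexagonal SAW law `hexSAWLaw`, for every
Dobrushin domain and endpoint approximation, with a threshold chosen PER SHELL (independent of the mesh).
HOW (exact identities + bookkeeping, no estimate is assumed): with `u := (ρ/R)^{1/3}` the target is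
`K u⁹`; thin shells (`1/u < 32`) and the both-endpoints-deep case of the cube-root trick are absorbed into
`K := max 32⁹ (2/d₀)⁹`; otherwise the hypotheses are taken at the mesh-free aspect `A := 1/(8u) ≥ 4` and
tolerance `u⁹`, on the sub-shell `(s, s/u)` missing both marked points (`exists_subshell`), lattice radius
`N := s/(uδ) - 3`, inner radius `N/A` (`tight_subshell_parameters`). At a COARSE mesh (`N < N₀`) the event
is EMPTY once the threshold exceeds twice the number of faces that can lie in the inner ball (a SAW visits
each face once, `card_le_of_vertexTraversals_nodup`; the faces form a finite set fixed by the shell since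
then `1/δ < (N₀+3)/ρ`); at a FINE mesh the landed reductions apply verbatim (`embLaw_apply_le_ofReal`,
`vertexTraversals_of_hasTraversals_toCurve`, `sum_vertexTraversals_le_chordal` / `…_rooted` with
`exists_reverse_event_le`, fed by `arcSums_of_arcShellBound` and `arcSums_of_rootedTight`).
-/

noncomputable section

open scoped BigOperators Classical
open MeasureTheory Filter Topology Set Metric
open Literature.Probability.LatticeModels Literature.Probability.RandomPlanarGeometry
  Literature.Probability.RandomPlanarGeometry.SAW
open Summit.CriticalPhenomena.SAWScalingLimit.Theorems.ObservableToSLE.Negative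
  (finite_hexDomainSAW finite_embMeshVertices_hex)
open Summit.CriticalPhenomena.SAWScalingLimit.Cruxes.DefectDecoherence.TipMartingaleDepthInduction.WallExitTwoPoint
  (dist_hexCenter_le_one_of_adj)

namespace Summit.CriticalPhenomena.SAWScalingLimit.Theorems.HexTight.Reversal

/-! ## The rooted arc sums with a lattice root step -/

/-- The rooted tightness bound (hypothesis 2, with the root step a genuine lattice edge `q ∼ p` that is
also an `H`-edge, applied to the graph `Ω_δ` ENLARGED by the honeycomb edges of the closed `(N+1)`-disc,
`isVirgin_sup_disc`) yields the rooted arc inequality over arcs using edges of `Ω_δ` that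
`sum_vertexTraversals_le_rooted` consumes (an edge of `Ω_δ` is an edge of `ℍ`, `embDomainGraph_le`). -/
theorem arcSums_of_rootedTight {Ω : Set ℂ} {δ : ℝ} (hδ : 0 < δ) {z₀ : ℂ} {N n K : ℝ} {k₂ kk : ℕ}
    (hk : k₂ ≤ kk) (hΩ : Metric.closedBall ((δ : ℂ) * z₀) (δ * (N + 1)) ⊆ Ω) {b : HexVertex}
    (hb : dist (hexCenter b) z₀ ≤ n)
    (h2N : ∀ (H : SimpleGraph HexVertex) (Λ : Finset HexVertex) (w : Sym2 HexVertex)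
      (p q : HexVertex), IsVirgin H Λ z₀ N → Straddles Λ z₀ N w → dist (hexCenter p) z₀ ≤ n →
      hexGraph.Adj q p → H.Adj q p → travMass H (Λ.erase p) w s(q, p) k₂ z₀ n (N / 2) ≤
        K * arcMass H (Λ.erase p) w s(q, p)) :
    ∀ (Λ' : Finset HexVertex) (m : Sym2 HexVertex) (q : HexVertex),
      (∀ v : HexVertex, dist (hexCenter v) z₀ < N → v ∈ Λ') →
      (∃ u c : HexVertex, m = s(u, c) ∧ hexGraph.Adj u c ∧ u ∉ Λ' ∧ c ∈ Λ' ∧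
        c ∈ embMeshDomain hexGraph hexCenter Ω δ ∧ dist (hexCenter c) z₀ ≤ N ∧
        N < dist (hexCenter u) z₀) →
      (hexDomainGraph Ω δ).Adj q b →
      ∑ α : HexMidEdgeSAW (Λ'.erase b) m s(q, b), (if α.verts.IsChain (hexDomainGraph Ω δ).Adj ∧
          (⟨polyline α.points⟩ : Curve ℂ).HasTraversals kk z₀ n (N / 2) then
            hexCriticalFugacity ^ α.length else 0) ≤
        K * ∑ α : HexMidEdgeSAW (Λ'.erase b) m s(q, b),
          (if α.verts.IsChain (hexDomainGraph Ω δ).Adj then hexCriticalFugacity ^ α.length else 0) := by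
  intro Λ' m q hmem hm hqb
  obtain ⟨u, c, rfl, hadj, hu, hc, hcmesh, hcN, huN⟩ := hm
  have h := h2N _ Λ' _ b q (isVirgin_sup_disc (Ω := Ω) (δ := δ) hmem)
    ⟨u, c, rfl, hadj, hu, hc, hcN, huN⟩ hb (embDomainGraph_le _ _ _ _ hqb)
    ((SimpleGraph.sup_adj _ _ _ _).2 (Or.inl hqb))
  simp only [travMass, arcMass] at h
  have hu' : u ∉ Λ'.erase b := fun h' => hu (Finset.mem_of_mem_erase h')
  exact sum_ite_and_le_of_iff_of_imp (P' := fun α => IsHArc _ α)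
    (Q' := fun α => (arcCurve α).HasTraversals k₂ z₀ n (N / 2))
    (fun α : HexMidEdgeSAW (Λ'.erase b) s(u, c) s(q, b) => hexCriticalFugacity ^ α.length)
    (fun α => pow_nonneg hexCriticalFugacity_pos_lt_one.1.le _)
    (fun α => isChain_sup_disc_iff hδ hΩ hu' hcmesh α)
    (fun α hα => Curve.HasTraversals.of_le hα hk) h

/-! ## The registered stub -/

set_option maxHeartbeats 1000000 in
/-- **stub 5' — VIRGINIZATION, rate-free** of the crux skeleton `reversal-virgin-disc`: chordal
(`ArcTraversalTight`) and rooted (`RootedTraversalTight`) traversal tightness imply Aizenman–Burchard's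
(H1) on INTERIOR shells for the critical hexagonal SAW law, for every Dobrushin domain and endpoint
approximation, with exponent `3`, a constant `K` depending on `(D, a, b)` only and a threshold chosen per
shell. Proof: with `u := (ρ/R)^{1/3}`, thin shells (`1/u < 32`) and the both-endpoints-deep case of the
cube-root trick (`exists_subshell`; the endpoint limits separate `a_δ`, `b_δ`) are absorbed into
`K := max 32⁹ (2/d₀)⁹`; otherwise both hypotheses are taken at aspect `A := 1/(8u) ≥ 4` and tolerance
`u⁹` (thresholds `k₁, k₂`, radius `N₀`); the shell's threshold is `max (2(max k₁ k₂ + 1)) (2(#F + 1))`,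
`F` the finite set of faces that can lie in the inner lattice ball at a coarse mesh (lattice radius
`N < N₀`), where the event is empty (`card_le_of_vertexTraversals_nodup`); at a fine mesh the event is
transported to the vertex sequence and the domain Markov reductions `sum_vertexTraversals_le_chordal` /
`…_rooted` (reversing the walk when `a_δ` is deep) are fed with the tightness bounds on `Ω_δ` enlarged
inside the disc (`arcSums_of_arcShellBound`, `arcSums_of_rootedTight`; law = `embLaw_apply_le_ofReal`). -/
theorem stub_virginizationTight :
    (∀ A : ℝ, 4 ≤ A → ∀ η : ℝ, 0 < η → ∃ (k₀ : ℕ) (N₀ : ℝ), 0 < N₀ ∧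
      ∀ (H : SimpleGraph HexVertex) (Λ : Finset HexVertex) (z₀ : ℂ) (N : ℝ)
        (w w' : Sym2 HexVertex), N₀ ≤ N →
        IsVirgin H Λ z₀ N → Straddles Λ z₀ N w → Straddles Λ z₀ N w' →
        travMass H Λ w w' k₀ z₀ (N / A) (N / 2) ≤ η * arcMass H Λ w w') →
    (∀ A : ℝ, 4 ≤ A → ∀ η : ℝ, 0 < η → ∃ (k₀ : ℕ) (N₀ : ℝ), 0 < N₀ ∧
      ∀ (H : SimpleGraph HexVertex) (Λ : Finset HexVertex) (z₀ : ℂ) (N : ℝ)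
        (w : Sym2 HexVertex) (p q : HexVertex), N₀ ≤ N →
        IsVirgin H Λ z₀ N → Straddles Λ z₀ N w → dist (hexCenter p) z₀ ≤ N / A →
        hexGraph.Adj q p → H.Adj q p →
        travMass H (Λ.erase p) w s(q, p) k₀ z₀ (N / A) (N / 2) ≤
          η * arcMass H (Λ.erase p) w s(q, p)) →
    ∀ (D : DobrushinDomain) (a b : ℝ → HexVertex),
      IsEmbEndpointApprox hexGraph hexCenter D a b →
      ∃ (k : ℂ → ℝ → ℝ → ℕ) (K lam δ₀ : ℝ), 0 ≤ K ∧ 2 < lam ∧ 0 < δ₀ ∧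
        ∀ δ ∈ Set.Ioc 0 δ₀, ∀ (x : ℂ) (ρ R : ℝ), δ ≤ ρ → ρ < R → R ≤ 1 →
          Metric.closedBall x R ⊆ D.carrier →
          hexSAWLaw D.carrier δ (a δ) (b δ)
            {γ | (⟨γ.walk.toCurve fun v => (δ : ℂ) * hexCenter v⟩ : Curve ℂ).HasTraversals
              (k x ρ R) x ρ R} ≤ ENNReal.ofReal (K * (ρ / R) ^ lam) := by
  intro h1 h2 D a b hab
  -- constants depending on `(D, a, b)` only
  have hd : D.pt 0 ≠ D.pt 1 := fun e => absurd (D.pt_injective e) (by decide)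
  obtain ⟨d₀, hd₀⟩ : ∃ d₀ : ℝ, d₀ = dist (D.pt 0) (D.pt 1) / 2 := ⟨_, rfl⟩
  have hd₀pos : 0 < d₀ := by rw [hd₀]; exact half_pos (dist_pos.2 hd)
  obtain ⟨K, hK⟩ : ∃ K : ℝ, K = max ((32 : ℝ) ^ 9) ((2 / d₀) ^ 9) := ⟨_, rfl⟩
  have hK32 : (32 : ℝ) ^ 9 ≤ K := hK ▸ le_max_left _ _
  have hKd : (2 / d₀) ^ 9 ≤ K := hK ▸ le_max_right _ _
  have hK1 : 1 ≤ K := le_trans (by norm_num) hK32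
  have hK0 : 0 ≤ K := zero_le_one.trans hK1
  -- the mesh threshold from the endpoint limits
  have hev : ∀ᶠ δ : ℝ in 𝓝[>] 0, dist ((δ : ℂ) * hexCenter (a δ)) (D.pt 0) < d₀ / 2 ∧
      dist ((δ : ℂ) * hexCenter (b δ)) (D.pt 1) < d₀ / 2 :=
    (Metric.tendsto_nhds.1 hab.tendsto_fst _ (half_pos hd₀pos)).and
      (Metric.tendsto_nhds.1 hab.tendsto_snd _ (half_pos hd₀pos))
  obtain ⟨δ₁, hδ₁, hgood⟩ := mem_nhdsGT_iff_exists_Ioo_subset.1 hev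
  have hδ₁pos : 0 < δ₁ := hδ₁
  -- reduction to one shell at a time: the threshold is chosen per shell
  suffices key : ∀ (x : ℂ) (ρ R : ℝ), ∃ kk : ℕ, ∀ δ ∈ Set.Ioc 0 (δ₁ / 2), δ ≤ ρ → ρ < R → R ≤ 1 →
      Metric.closedBall x R ⊆ D.carrier →
      hexSAWLaw D.carrier δ (a δ) (b δ)
        {γ | (⟨γ.walk.toCurve fun v => (δ : ℂ) * hexCenter v⟩ : Curve ℂ).HasTraversals kk x ρ R} ≤
        ENNReal.ofReal (K * (ρ / R) ^ (3 : ℝ)) by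
    choose k hk using key
    exact ⟨k, K, 3, δ₁ / 2, hK0, by norm_num, by positivity, fun δ hδ x ρ R h₁ h₂ h₃ h₄ =>
      hk x ρ R δ hδ h₁ h₂ h₃ h₄⟩
  intro x ρ R
  by_cases hshell : 0 < ρ ∧ ρ < R ∧ R ≤ 1
  swap
  · exact ⟨0, fun δ hδ hδρ hρR hR1 _ => (hshell ⟨hδ.1.trans_le hδρ, hρR, hR1⟩).elim⟩
  obtain ⟨hρ, hρR, hR1⟩ := hshell
  -- trivial bound
  by_cases htriv : 1 ≤ K * (ρ / R) ^ (3 : ℝ)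
  · exact ⟨0, fun δ _ _ _ _ _ => (embLaw_apply_le_one _).trans (ENNReal.one_le_ofReal.2 htriv)⟩
  rw [not_le] at htriv
  -- the aspect parameter `u = (ρ/R)^{1/3}`
  have hR : 0 < R := hρ.trans hρR
  have hθ0 : 0 < ρ / R := div_pos hρ hR
  have hθ1 : ρ / R ≤ 1 := (div_le_one hR).2 hρR.le
  obtain ⟨hu0, hu1, hu3, -⟩ := rpow_third_facts hθ0 hθ1
  obtain ⟨u, hu⟩ : ∃ u : ℝ, u = (ρ / R) ^ (1 / 3 : ℝ) := ⟨_, rfl⟩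
  rw [← hu] at hu0 hu1 hu3
  have hθ9 : (ρ / R) ^ (3 : ℝ) = u ^ 9 := by
    rw [show (3 : ℝ) = ((3 : ℕ) : ℝ) by norm_num, Real.rpow_natCast, ← hu3]; ring
  rw [hθ9] at htriv ⊢
  have hRu : R = ρ / u ^ 3 := by rw [hu3]; field_simp
  have hu9 : 0 < u ^ 9 := by positivity
  have hlt1 : ∀ c : ℝ, 0 ≤ c → c ^ 9 ≤ K → c * u < 1 := by
    intro c hc hcK
    by_contra hge
    rw [not_lt] at hge
    have h1 : 1 ≤ (c * u) ^ 9 := one_le_pow₀ hge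
    have h2 : (c * u) ^ 9 ≤ K * u ^ 9 := by
      rw [mul_pow]; exact mul_le_mul_of_nonneg_right hcK hu9.le
    linarith
  have h32 : 32 ≤ 1 / u := by
    rw [le_div_iff₀ hu0]; linarith [hlt1 32 (by norm_num) hK32]
  have hud : 2 * u < d₀ := by
    have := hlt1 (2 / d₀) (by positivity) hKd
    rwa [div_mul_eq_mul_div, div_lt_one hd₀pos] at this
  -- the mesh-free aspect ratio and tolerance fed to the hypotheses
  obtain ⟨A, hA⟩ : ∃ A : ℝ, A = 1 / (8 * u) := ⟨_, rfl⟩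
  have hA4 : 4 ≤ A := by
    rw [hA, le_div_iff₀ (by positivity)]
    have := (le_div_iff₀ hu0).1 h32
    linarith
  obtain ⟨k₁, N₁, hN₁, h1'⟩ := h1 A hA4 (u ^ 9) hu9
  obtain ⟨k₂, N₂, hN₂, h2'⟩ := h2 A hA4 (u ^ 9) hu9
  obtain ⟨N₀, hN₀⟩ : ∃ N₀ : ℝ, N₀ = max N₁ N₂ := ⟨_, rfl⟩
  have hN₀pos : 0 < N₀ := hN₀ ▸ lt_max_of_lt_left hN₁
  have hN₁₀ : N₁ ≤ N₀ := hN₀ ▸ le_max_left _ _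
  have hN₂₀ : N₂ ≤ N₀ := hN₀ ▸ le_max_right _ _
  -- the finite set of faces that can be near `x/δ` at a coarse mesh
  obtain ⟨Rb, hRb⟩ : ∃ Rb : ℝ, Rb = (‖x‖ + ρ) * ((N₀ + 3) / ρ) + 1 := ⟨_, rfl⟩
  have hfinF : {v : HexVertex | ‖hexCenter v‖ < Rb}.Finite := by
    refine (finite_embMeshVertices_hex (Metric.isBounded_ball (x := (0 : ℂ)) (r := Rb))
      one_ne_zero).subset fun v hv => ?_
    have : ‖hexCenter v‖ < Rb := hv
    simpa only [mem_embMeshVertices_iff, Complex.ofReal_one, one_mul, Metric.mem_ball,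
      dist_zero_right] using this
  set F := hfinF.toFinset with hFdef
  refine ⟨max (2 * (max k₁ k₂ + 1)) (2 * (F.card + 1)), fun δ hδ hδρ _ _ hball => ?_⟩
  -- at a fixed mesh `δ`
  have hδpos : 0 < δ := hδ.1
  have hδ' : (δ : ℂ) ≠ 0 := by exact_mod_cast hδpos.ne'
  obtain ⟨hA0, hB1⟩ := hgood (show δ ∈ Set.Ioo 0 δ₁ from ⟨hδ.1, by linarith [hδ.2]⟩)
  have hne : a δ ≠ b δ := by
    intro h
    rw [h] at hA0
    linarith [dist_pos.2 hd, dist_triangle (D.pt 0) ((δ : ℂ) * hexCenter (b δ)) (D.pt 1),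
      dist_comm (D.pt 0) ((δ : ℂ) * hexCenter (b δ))]
  haveI := finite_hexDomainSAW D.isBounded hδpos.ne' (a δ) (b δ)
  haveI := finite_hexDomainSAW D.isBounded hδpos.ne' (b δ) (a δ)
  haveI := Fintype.ofFinite (HexDomainSAW D.carrier δ (a δ) (b δ))
  haveI := Fintype.ofFinite (HexDomainSAW D.carrier δ (b δ) (a δ))
  have hxc := hexCriticalFugacity_pos_lt_one.1
  -- the lattice data
  obtain ⟨z₀, hz₀⟩ : ∃ z₀ : ℂ, z₀ = x / δ := ⟨_, rfl⟩
  have hxz : x = (δ : ℂ) * z₀ := by rw [hz₀]; field_simp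
  have hdist : ∀ v : HexVertex, dist ((δ : ℂ) * hexCenter v) x = δ * dist (hexCenter v) z₀ := by
    intro v
    rw [hxz, dist_eq_norm, ← mul_sub, norm_mul, Complex.norm_real, Real.norm_of_nonneg hδpos.le,
      ← dist_eq_norm]
  have hedge : ∀ u v : HexVertex, hexGraph.Adj u v → dist (hexCenter u) (hexCenter v) ≤ 1 :=
    fun u v h => dist_hexCenter_le_one_of_adj h.symm
  -- the sub-shell missing both marked points
  obtain ⟨s, hρs, hsu, hs2, hAs, hBs⟩ := exists_subshell ρ u (dist ((δ : ℂ) * hexCenter (a δ)) x)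
    (dist ((δ : ℂ) * hexCenter (b δ)) x) hρ hu0 hu1
  have hδs : δ ≤ s := hδρ.trans hρs
  have hspos : 0 < s := hδpos.trans_le hδs
  have hSR : s / u ≤ R := by rwa [hRu]
  obtain ⟨N, hNdef⟩ : ∃ N : ℝ, N = s / u / δ - 3 := ⟨_, rfl⟩
  by_cases hcoarse : N < N₀
  · -- coarse mesh: the event is empty (a SAW visits each of the `≤ #F` near faces once)
    refine (measure_mono fun ω hω => ?_ : _ ≤ hexSAWLaw D.carrier δ (a δ) (b δ) ∅).trans (by simp)
    exfalso
    have h' := vertexTraversals_of_hasTraversals_toCurve ω hδpos hedge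
      (Curve.HasTraversals.of_le hω (le_max_right _ _))
    rw [← hz₀] at h'
    have hrR' : (ρ + δ) / δ < (R - δ) / δ := by
      rw [div_lt_div_iff_of_pos_right hδpos]
      have h32u : 32 * u ≤ 1 := (le_div_iff₀ hu0).1 h32
      have hu3le : u ^ 3 ≤ u := pow_le_of_le_one hu0.le hu1 (by norm_num)
      have : 4 * ρ ≤ R := by
        rw [hRu, le_div_iff₀ (by positivity)]; nlinarith
      linarith
    have h1δ : 1 / δ < (N₀ + 3) / ρ := by
      rw [div_lt_div_iff₀ hδpos hρ, one_mul]
      have hsus : s ≤ s / u := by rw [le_div_iff₀ hu0]; nlinarith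
      have : s / u < (N₀ + 3) * δ := by
        rw [hNdef, sub_lt_iff_lt_add, div_lt_iff₀ hδpos] at hcoarse; linarith
      linarith
    have hz₀n : ‖z₀‖ = ‖x‖ / δ := by
      rw [hz₀, norm_div, Complex.norm_real, Real.norm_of_nonneg hδpos.le]
    have hcard := card_le_of_vertexTraversals_nodup F ω.isPath.support_nodup hrR'
      (fun v _ hvr => ?_) h'
    · omega
    rw [hFdef, hfinF.mem_toFinset]
    show ‖hexCenter v‖ < Rb
    have hv1 : ‖hexCenter v‖ ≤ dist (hexCenter v) z₀ + ‖z₀‖ := by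
      simpa only [dist_zero_right] using dist_triangle (hexCenter v) z₀ 0
    calc ‖hexCenter v‖ ≤ (ρ + δ) / δ + ‖x‖ / δ := by linarith
      _ = (‖x‖ + ρ) * (1 / δ) + 1 := by field_simp; ring
      _ < (‖x‖ + ρ) * ((N₀ + 3) / ρ) + 1 := by
          linarith [mul_lt_mul_of_pos_left h1δ (add_pos_of_nonneg_of_pos (norm_nonneg x) hρ)]
      _ = Rb := hRb.symm
  -- fine mesh: the lattice parameters of the sub-shell
  rw [not_lt] at hcoarse
  obtain ⟨n, hndef⟩ : ∃ n : ℝ, n = N / A := ⟨_, rfl⟩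
  have hnA : n = 8 * u * N := by rw [hndef, hA]; field_simp
  obtain ⟨hNpos, hrR', hrn', hNR', hnN⟩ : 0 < N ∧ s / δ + 2 + 1 < N - 1 ∧ s / δ + 2 + 1 ≤ n ∧
      N / 2 + 1 ≤ N - 1 ∧ n ≤ N := by
    rw [hnA, hNdef]; exact tight_subshell_parameters hδpos hδs hu0 h32
  have hNδ : δ * (N + 1) = s / u - 2 * δ := by
    rw [hNdef]; field_simp; ring
  have hΩ' : Metric.closedBall ((δ : ℂ) * z₀) (δ * (N + 1)) ⊆ D.carrier := by
    rw [← hxz, hNδ]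
    exact (Metric.closedBall_subset_closedBall (by linarith)).trans hball
  -- the vertex set: vertices of `Ω_δ` and the cells of the open `N`-disc
  have hfin₁ : (embMeshDomain hexGraph hexCenter D.carrier δ).Finite :=
    (finite_embMeshVertices_hex D.isBounded hδpos.ne').subset (embMeshDomain_subset _ _ _ _)
  have hfin₂ : {v : HexVertex | dist (hexCenter v) z₀ < N}.Finite := by
    refine (finite_embMeshVertices_hex (Metric.isBounded_ball (x := z₀) (r := N))
      one_ne_zero).subset fun v hv => ?_
    have : dist (hexCenter v) z₀ < N := hv
    simpa only [mem_embMeshVertices_iff, Complex.ofReal_one, one_mul, Metric.mem_ball] using this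
  set Λ₀ := hfin₁.toFinset ∪ hfin₂.toFinset with hΛ₀
  have hdisc : ∀ v : HexVertex, dist (hexCenter v) z₀ < N → v ∈ Λ₀ := fun v hv =>
    Finset.mem_union_right _ (hfin₂.mem_toFinset.2 hv)
  have hmeshΛ : ∀ v ∈ embMeshDomain hexGraph hexCenter D.carrier δ, v ∈ Λ₀ := fun v hv =>
    Finset.mem_union_left _ (hfin₁.mem_toFinset.2 hv)
  -- it suffices to dominate the event by a finite set of SAWs of mass fraction `≤ u⁹`
  have hCK : u ^ 9 ≤ K * u ^ 9 := le_mul_of_one_le_left hu9.le hK1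
  suffices key : ∃ S : Finset (HexDomainSAW D.carrier δ (a δ) (b δ)),
      ∑ ω ∈ S, hexCriticalFugacity ^ ω.vertexCount ≤
          u ^ 9 * ∑ ω : HexDomainSAW D.carrier δ (a δ) (b δ), hexCriticalFugacity ^ ω.vertexCount ∧
        ∀ ω : HexDomainSAW D.carrier δ (a δ) (b δ),
          (⟨ω.walk.toCurve fun v => (δ : ℂ) * hexCenter v⟩ : Curve ℂ).HasTraversals
            (2 * (max k₁ k₂ + 1)) x ρ R → ω ∈ S by
    obtain ⟨S, hSC, hS⟩ := key
    have hnn : ∀ ω : HexDomainSAW D.carrier δ (a δ) (b δ), 0 ≤ hexCriticalFugacity ^ ω.vertexCount :=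
      fun ω => pow_nonneg hxc.le _
    refine (embLaw_apply_le_ofReal hxc.le hu9.le ?_).trans (ENNReal.ofReal_le_ofReal hCK)
    calc _ ≤ ∑ ω ∈ S, hexCriticalFugacity ^ ω.vertexCount :=
          Finset.sum_le_sum_of_subset_of_nonneg (fun ω hω => hS ω
            (Curve.HasTraversals.of_le (Finset.mem_filter.1 hω).2 (le_max_left _ _)))
            fun ω _ _ => hnn ω
      _ ≤ _ := hSC
  -- the event implies the discrete event on the vertex sequence, in lattice units
  have hincl : ∀ ω : HexDomainSAW D.carrier δ (a δ) (b δ),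
      (⟨ω.walk.toCurve fun v => (δ : ℂ) * hexCenter v⟩ : Curve ℂ).HasTraversals
        (2 * (max k₁ k₂ + 1)) x ρ R →
      ∃ ι κ : Fin (2 * (max k₁ k₂ + 1)) → Fin (ω.walk.support.map hexCenter).length,
        (∀ m, ι m ≤ κ m) ∧
        (∀ m, (dist ((ω.walk.support.map hexCenter).get (ι m)) z₀ ≤ s / δ + 2 ∧
            N - 1 ≤ dist ((ω.walk.support.map hexCenter).get (κ m)) z₀) ∨
          (N - 1 ≤ dist ((ω.walk.support.map hexCenter).get (ι m)) z₀ ∧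
            dist ((ω.walk.support.map hexCenter).get (κ m)) z₀ ≤ s / δ + 2)) ∧
        ∀ ⦃m m'⦄, m < m' → κ m ≤ ι m' := by
    intro ω hω
    have h' := vertexTraversals_of_hasTraversals_toCurve ω hδpos hedge
      (hω.mono' hρs (by linarith : s / u - 3 * δ ≤ R))
    rw [← hz₀] at h'
    refine vertexTraversals_mono h' ?_ ?_
    · rw [div_add' _ _ _ hδpos.ne', div_le_div_iff_of_pos_right hδpos]; linarith
    · rw [hNdef, le_div_iff₀ hδpos, sub_mul, sub_mul, div_mul_cancel₀ _ hδpos.ne']; linarith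
  have hfar : ∀ v : HexVertex, s / u < dist ((δ : ℂ) * hexCenter v) x →
      N < dist (hexCenter v) z₀ := by
    intro v hv
    rw [hdist] at hv
    rw [hNdef]
    have : s / u / δ < dist (hexCenter v) z₀ := by rwa [div_lt_iff₀' hδpos]
    linarith
  have hdeep : ∀ v : HexVertex, dist ((δ : ℂ) * hexCenter v) x ≤ s →
      dist (hexCenter v) z₀ ≤ n := by
    intro v hv
    rw [hdist] at hv
    have : dist (hexCenter v) z₀ ≤ s / δ := by rwa [le_div_iff₀' hδpos]
    linarith
  -- the specialised tightness bounds (inner radius `n = N/A`)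
  have h1N : ∀ (H : SimpleGraph HexVertex) (Λ : Finset HexVertex) (w w' : Sym2 HexVertex),
      IsVirgin H Λ z₀ N → Straddles Λ z₀ N w → Straddles Λ z₀ N w' →
      travMass H Λ w w' k₁ z₀ n (N / 2) ≤ u ^ 9 * arcMass H Λ w w' := fun H Λ w w' hV hw hw' => by
    rw [hndef]; exact h1' H Λ z₀ N w w' (hN₁₀.trans hcoarse) hV hw hw'
  have h2N : ∀ (H : SimpleGraph HexVertex) (Λ : Finset HexVertex) (w : Sym2 HexVertex)
      (p q : HexVertex), IsVirgin H Λ z₀ N → Straddles Λ z₀ N w → dist (hexCenter p) z₀ ≤ n →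
      hexGraph.Adj q p → H.Adj q p → travMass H (Λ.erase p) w s(q, p) k₂ z₀ n (N / 2) ≤
        u ^ 9 * arcMass H (Λ.erase p) w s(q, p) := fun H Λ w p q hV hw hp hqp hqp' => by
    rw [hndef] at hp ⊢; exact h2' H Λ z₀ N w p q (hN₂₀.trans hcoarse) hV hw hp hqp hqp'
  -- the rooted reduction, for either orientation of the walk
  have hrooted := fun {a' b' : HexVertex} [Fintype (HexDomainSAW D.carrier δ a' b')]
      (hab' : a' ≠ b') (ha' : N < dist (hexCenter a') z₀) (hb' : dist (hexCenter b') z₀ ≤ n) =>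
    sum_vertexTraversals_le_rooted Λ₀
      (fun ω v hv => hmeshΛ v (support_subset_embMeshDomain_of_ne ω hab' v hv)) hdisc
      (fun ω v hv => support_subset_embMeshDomain_of_ne ω hab' v hv) hxc.le hu9.le hrR'
      hrn' hNR' (by linarith) hnN hedge ha' hb'
      (arcSums_of_rootedTight hδpos (le_max_right k₁ k₂) hΩ' hb' h2N)
  rcases hAs with hAin | hAout <;> rcases hBs with hBin | hBout
  · -- both marked points deep: impossible below the aspect threshold
    exfalso
    have h1 : dist ((δ : ℂ) * hexCenter (a δ)) ((δ : ℂ) * hexCenter (b δ)) ≤ 2 * s := by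
      linarith [dist_triangle ((δ : ℂ) * hexCenter (a δ)) x ((δ : ℂ) * hexCenter (b δ)),
        dist_comm x ((δ : ℂ) * hexCenter (b δ))]
    have h2 : d₀ < dist ((δ : ℂ) * hexCenter (a δ)) ((δ : ℂ) * hexCenter (b δ)) := by
      linarith [dist_triangle4 (D.pt 0) ((δ : ℂ) * hexCenter (a δ)) ((δ : ℂ) * hexCenter (b δ))
        (D.pt 1), dist_comm (D.pt 0) ((δ : ℂ) * hexCenter (a δ))]
    have h3 : s ≤ u := by
      refine hs2.trans ?_
      rw [div_le_iff₀ (by positivity)]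
      have : ρ / u ^ 3 ≤ 1 := hRu ▸ hR1
      rw [div_le_iff₀ (by positivity), one_mul] at this
      calc ρ ≤ u ^ 3 := this
        _ = u * u ^ 2 := by ring
    linarith
  · -- `a δ` deep, `b δ` far: reverse the walks and use the rooted reduction from `b δ`
    obtain ⟨S, hS, hmem⟩ := exists_reverse_event_le (E := fun L : List HexVertex =>
      ∃ ι κ : Fin (2 * (max k₁ k₂ + 1)) → Fin (L.map hexCenter).length, (∀ m, ι m ≤ κ m) ∧
        (∀ m, (dist ((L.map hexCenter).get (ι m)) z₀ ≤ s / δ + 2 ∧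
            N - 1 ≤ dist ((L.map hexCenter).get (κ m)) z₀) ∨
          (N - 1 ≤ dist ((L.map hexCenter).get (ι m)) z₀ ∧
            dist ((L.map hexCenter).get (κ m)) z₀ ≤ s / δ + 2)) ∧
        ∀ ⦃m m'⦄, m < m' → κ m ≤ ι m') (hrooted hne.symm (hfar _ hBout) (hdeep _ hAin))
    refine ⟨S, hS, fun ω hω => hmem ω ?_⟩
    rw [List.map_reverse]
    exact vertexTraversals_reverse (hincl ω hω)
  · -- `a δ` far, `b δ` deep: the rooted reduction
    exact ⟨_, hrooted hne (hfar _ hAout) (hdeep _ hBin),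
      fun ω hω => mem_filter_univ_of_pred (hincl ω hω)⟩
  · -- both far: the chordal reduction
    exact ⟨_, sum_vertexTraversals_le_chordal Λ₀
      (fun ω v hv => hmeshΛ v (support_subset_embMeshDomain_of_ne ω hne v hv)) hdisc
      (fun ω v hv => support_subset_embMeshDomain_of_ne ω hne v hv) hxc.le hu9.le hrR'
      (by linarith) (by linarith) (by linarith) hedge (hfar _ hAout) (hfar _ hBout)
      (arcSums_of_arcShellBound hδpos (le_max_left k₁ k₂) hΩ' h1N),
      fun ω hω => mem_filter_univ_of_pred (hincl ω hω)⟩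

end Summit.CriticalPhenomena.SAWScalingLimit.Theorems.HexTight.Reversal

end
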